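import Summits.CriticalPhenomena.PercolationContinuityZ3.Theses.PercBurnResprinkle
import Literature.Probability.Percolation.PercolationProofs
import Literature.Probability.Percolation.StaticRenormalizationBlocks
import Literature.Probability.Percolation.BondPercolationSymmetry
import Literature.Probability.LatticeModels.StarBoundary
import HarnessLib
import Literature.Probability.Percolation.DependentStarPercolation
import Summits.CriticalPhenomena.PercolationContinuityZ3.Theorems.PercBurnResprinkleVacantReignitionFreshDominationAux
import Summits.CriticalPhenomena.PercolationContinuityZ3.Theorems.PercBurnResprinkleVacantReignitionCoarsePercolationAux

/-!
# Crux `PercBurnResprinkle.VacantReignition` (stmt-CriticalPhenomena-7203), line `slab-slice-avoidability` —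
# stub `stub_coarsePercolationCurtain`

(worker of lead prover-line-stmt-CriticalPhenomena-7203-c2-0; registered stub of the skeleton
`Cruxes/VacantReignition/Lines/slab_slice_avoidability.lean` (reshape v-c2), statement DEF-FREE over
tree vocabulary.)

**What is proved.** The COARSE PERCOLATION step of the separated ADKS renormalisation
(Ahlberg–Duminil-Copin–Kozma–Sidoravicius 2015, §2) at `d = 3`, for the CURTAIN events of the
slab line: there is an absolute constant `η₁ > 0` (we take `η₁ = δ^100 / 2`, `δ = 1 / (204 · 200^100)`)
such that for aspect `k ≥ 1`, cost fraction `κ`, coarse spacing `S ≥ k + 5`, block scale `L ≥ 1` and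
levels `p, q`: if for every coarse planar site `x ∈ ℤ²` the ENVIRONMENT event `¬CurtainOK_p(κ, x)`
(some self-avoiding `★`-chain `γ` of blocks of the square `|zᵢ - S xᵢ| ≤ 3S` of extent `≥ S` has no
sub-family of `≥ κ|γ|` UNTOUCHED blocks) and the FRESH-field event `NecklaceBad_q(κ, x)` (some such
chain has a sub-family of `≥ κ|γ|` NON-GOOD blocks) each have `labelMeasure`-probability `≤ η₁`, then
under the product `labelMeasure ⊗ labelMeasure` of the two label fields, with probability `≥ 1/2` the
coarse site `0` is OPEN (`CurtainOK_p(κ, 0)(π.1) ∧ ¬NecklaceBad_q(κ, 0)(π.2)`) and the `★`-cluster of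
`0` in the set of OPEN sites is infinite.

**Proof.** Verbatim the proof of the landed `stub_coarsePercolation` of line `holes-are-fresh`
(`PercBurnResprinkleVacantReignitionCoarsePercolation.lean`), whose measure theory is over ABSTRACT
event families (`PercBurnResprinkleVacantReignitionCoarsePercolationAux.lean`, names
`vacantReignition_cp_*`).  The tree's finitely dependent planar `★`-Peierls criterion
`le_measureReal_infinite_starCluster_of_good` (`DependentStarPercolation.lean`; Grimmett 1999, §7.4
and §8.6) with `d = 2`, range `r = 9` and `δ = 1/(204 · 200^100)` (so that
`2 (10² + 2) (2 · 10²)^100 δ = 1`) reduces the claim to the sparse product bound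
`μ⊗μ (⋂_{b ∈ T} OPEN(b)ᶜ) ≤ δ^{100 #T}` for finite `T ⊆ ℤ²` with pairwise sup-distance `> 9`.
Since `OPEN(b)ᶜ ⊆ {¬CurtainOK(b)(π.1)} ∪ {NecklaceBad(b)(π.2)}`, the intersection is covered by the
`2^{#T}` product sets `{∀ b ∈ T₁, ¬CurtainOK(b)} ×ˢ {∀ b ∈ T ∖ T₁, NecklaceBad(b)}`, and `μ⊗μ` of a
product set factorises (`vacantReignition_cp_prod_real_biInter_compl_le`).  WITHIN each field the
events at distinct sites of `T` are independent with probability `≤ η₁` each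
(`vacantReignition_cp_real_biInter_le_pow`): both events are measurable and read only the TOUCHED /
GOOD indicators of the blocks `z` of the square of `b` — the chain hypothesis `∀ z ∈ γ, |zᵢ - S bᵢ| ≤ 3S`
precedes every use of an indicator, and the indicators are read only at `z ∈ F ⊆ γ` —, which are
cylinder events of radius `≤ S(2L+1)` about `(2L+1)(0, z₀, z₁)` (`vacantReignition_cp_dependsOn_touched`,
`vacantReignition_cp_dependsOn_good`; this uses `(2k+6)L + 3 ≤ S(2L+1)`, i.e. `k + 5 ≤ S`), hence
supported in the window `(2L+1)·(0, S b₀, S b₁) + B(4 S (2L+1))`; the windows of `9`-separated sites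
are disjoint (`vacantReignition_cp_disjoint_windows`), and disjointly supported events of the i.i.d.
label field are independent.  Each summand is thus `≤ η₁^{#T₁} η₁^{#T - #T₁}`, and the sum over `T₁`
is `(2 η₁)^{#T} = δ^{100 #T}`.

Design: no definitions; the events are those spelled out in the registered signature.  This file adds
the four generic measurability / locality lemmas (`vacantReignition_cpc_*`) for events of the
LIST shape of `¬CurtainOK` / `NecklaceBad` (propositional functions of a countable family of events
`t z` / `g z` read only at indices `z ∈ F ⊆ γ` with `R z` for all `z ∈ γ`), the analogues of
`vacantReignition_cp_measurableSet_notHarmless / _blocked`, `vacantReignition_cp_dependsOn_notHarmless /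
_blocked`; everything else is imported.  Not here: the bounds `≤ η₁` themselves (neighbour stubs
`stub_levelShiftCurtain`, `stub_necklacePeierls`) and the deterministic gluing (`stub_dualityCurtain`,
`stub_coarseGlue`).

## References

* D. Ahlberg, H. Duminil-Copin, G. Kozma, V. Sidoravicius, *Seven-dimensional forest fires*,
  Ann. Inst. Henri Poincaré Probab. Stat. 51 (2015) 862–866, §2 [AhlbergEtAl2015].
* G. Grimmett, *Percolation*, 2nd ed., Springer 1999, §7.4 pp. 178–189 and §8.6 pp. 222–223
  [GrimmettPercolation1999].
* T. M. Liggett, R. H. Schonmann, A. M. Stacey, *Domination by product measures*, Ann. Probab. 25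
  (1997) 71–95, §0 [LiggettSchonmannStacey1997].
-/

noncomputable section

namespace Summit.CriticalPhenomena.PercolationContinuityZ3.Theorems

open MeasureTheory ProbabilityTheory Set
open Literature.Probability.Percolation Literature.Probability.LatticeModels

/-! ### List-shaped events of a countable family of events: measurability and locality -/

/-- **Measurability of `¬CurtainOK`-shaped events.** For a countable index type `α`, measurable
predicates `t z` (`z ∈ α`) and ARBITRARY (sample-independent) predicates `R` on indices, `C`, `E` on
lists and `B` on lists and finite sets, the event
`{U | ¬ ∀ γ : List α, γ.Nodup → C γ → (∀ z ∈ γ, R z) → E γ → ∃ F, (∀ z ∈ F, z ∈ γ ∧ ¬ t z U) ∧ B γ F}`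
is measurable (countably many `∀`/`∃`/`→`/`∧`/`¬` of measurable propositions; `List α` and `Finset α`
are countable). [folklore] -/
theorem vacantReignition_cpc_measurableSet_notCurtain {Ω α : Type*} [MeasurableSpace Ω]
    [Countable α] (R : α → Prop) (C E : List α → Prop) (B : List α → Finset α → Prop)
    (t : α → Ω → Prop) (ht : ∀ z, Measurable (t z)) :
    MeasurableSet {U : Ω | ¬ ∀ γ : List α, γ.Nodup → C γ → (∀ z ∈ γ, R z) → E γ →
      ∃ F : Finset α, (∀ z ∈ F, z ∈ γ ∧ ¬ t z U) ∧ B γ F} :=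
  measurableSet_setOf.2 <| Measurable.not <| Measurable.forall fun _ =>
    measurable_const.imp <| measurable_const.imp <| measurable_const.imp <| measurable_const.imp <|
      Measurable.exists fun _ => Measurable.and
        (Measurable.forall fun z => measurable_const.imp (measurable_const.and (ht z).not))
        measurable_const

/-- **Measurability of `NecklaceBad`-shaped events.** For a countable index type `α`, measurable
predicates `g z` and arbitrary predicates `R`, `C`, `E`, `B`, the event
`{U | ∃ γ : List α, γ.Nodup ∧ C γ ∧ (∀ z ∈ γ, R z) ∧ E γ ∧ ∃ F, (∀ z ∈ F, z ∈ γ ∧ ¬ g z U) ∧ B γ F}`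
is measurable. [folklore] -/
theorem vacantReignition_cpc_measurableSet_necklace {Ω α : Type*} [MeasurableSpace Ω] [Countable α]
    (R : α → Prop) (C E : List α → Prop) (B : List α → Finset α → Prop) (g : α → Ω → Prop)
    (hg : ∀ z, Measurable (g z)) :
    MeasurableSet {U : Ω | ∃ γ : List α, γ.Nodup ∧ C γ ∧ (∀ z ∈ γ, R z) ∧ E γ ∧
      ∃ F : Finset α, (∀ z ∈ F, z ∈ γ ∧ ¬ g z U) ∧ B γ F} :=
  measurableSet_setOf.2 <| Measurable.exists fun _ => measurable_const.and <|
    measurable_const.and <| measurable_const.and <| measurable_const.and <|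
      Measurable.exists fun _ => Measurable.and
        (Measurable.forall fun z => measurable_const.imp (measurable_const.and (hg z).not))
        measurable_const

/-- **Locality of `¬CurtainOK`-shaped events.** If every `t z` with `R z` depends only on the
coordinates in `W`, so does
`{U | ¬ ∀ γ, γ.Nodup → C γ → (∀ z ∈ γ, R z) → E γ → ∃ F, (∀ z ∈ F, z ∈ γ ∧ ¬ t z U) ∧ B γ F}`
(the event reads `t z U` only for `z ∈ F ⊆ γ`, where `R z`). [folklore] -/
theorem vacantReignition_cpc_dependsOn_notCurtain {ι α : Type*} {X : ι → Type*} (R : α → Prop)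
    (C E : List α → Prop) (B : List α → Finset α → Prop) (t : α → (Π e, X e) → Prop) (W : Set ι)
    (ht : ∀ z, R z → DependsOn (t z) W) :
    DependsOn (fun U : Π e, X e =>
      U ∈ {U : Π e, X e | ¬ ∀ γ : List α, γ.Nodup → C γ → (∀ z ∈ γ, R z) → E γ →
        ∃ F : Finset α, (∀ z ∈ F, z ∈ γ ∧ ¬ t z U) ∧ B γ F}) W := by
  intro U U' hUU'
  simp only [Set.mem_setOf_eq]
  refine propext (not_congr (forall_congr' fun γ => forall_congr' fun _ => forall_congr' fun _ =>
    forall_congr' fun hγ => forall_congr' fun _ => exists_congr fun F => and_congr_left' ?_))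
  exact forall₂_congr fun z hz => and_congr_right fun hzγ =>
    not_congr (Iff.of_eq (ht z (hγ z hzγ) hUU'))

/-- **Locality of `NecklaceBad`-shaped events.** If every `g z` with `R z` depends only on the
coordinates in `W`, so does
`{U | ∃ γ, γ.Nodup ∧ C γ ∧ (∀ z ∈ γ, R z) ∧ E γ ∧ ∃ F, (∀ z ∈ F, z ∈ γ ∧ ¬ g z U) ∧ B γ F}`
(the event reads `g z U` only for `z ∈ F ⊆ γ`, where `R z`). [folklore] -/
theorem vacantReignition_cpc_dependsOn_necklace {ι α : Type*} {X : ι → Type*} (R : α → Prop)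
    (C E : List α → Prop) (B : List α → Finset α → Prop) (g : α → (Π e, X e) → Prop) (W : Set ι)
    (hg : ∀ z, R z → DependsOn (g z) W) :
    DependsOn (fun U : Π e, X e =>
      U ∈ {U : Π e, X e | ∃ γ : List α, γ.Nodup ∧ C γ ∧ (∀ z ∈ γ, R z) ∧ E γ ∧
        ∃ F : Finset α, (∀ z ∈ F, z ∈ γ ∧ ¬ g z U) ∧ B γ F}) W := by
  intro U U' hUU'
  simp only [Set.mem_setOf_eq]
  refine propext (exists_congr fun γ => and_congr_right fun _ => and_congr_right fun _ =>
    and_congr_right fun hγ => and_congr_right fun _ => exists_congr fun F => and_congr_left' ?_)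
  exact forall₂_congr fun z hz => and_congr_right fun hzγ =>
    not_congr (Iff.of_eq (hg z (hγ z hzγ) hUU'))

/-! ### The stub -/

/-- **Coarse percolation of the OPEN coarse sites for the curtain events (ADKS planar
renormalisation, separated architecture, `d = 3`, slab line).** There is an absolute constant
`η₁ > 0` such that for `k ≥ 1`, any `κ`, `k + 5 ≤ S`, `L ≥ 1` and levels `p, q`: if every coarse
site `x ∈ ℤ²` satisfies `labelMeasure {U | ¬CurtainOK_p(κ, x)(U)} ≤ η₁` (CurtainOK: every
self-avoiding `★`-chain `γ` of blocks `z`, `|zᵢ - S xᵢ| ≤ 3S`, of extent `≥ S` in some coordinate,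
has a sub-family `F` of UNTOUCHED blocks with `κ |γ| ≤ #F`; TOUCHED: some vertex of the window
`(2L+1)(0, z₀, z₁) + B(blockR L k)` has a level-`p` arm to sup-distance `S(2L+1)`) and
`labelMeasure {U' | NecklaceBad_q(κ, x)(U')} ≤ η₁` (NecklaceBad: some such chain has a sub-family `F`
of NON-GOOD blocks with `κ |γ| ≤ #F`), then with `labelMeasure ⊗ labelMeasure`-probability `≥ 1/2`
the coarse site `0` is OPEN (`CurtainOK_p(κ, 0)(π.1) ∧ ¬NecklaceBad_q(κ, 0)(π.2)`) and the `★`-cluster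
of `0` in the OPEN sites is infinite.  This is the "good coarse boxes form a finitely dependent,
highly supercritical planar site process" step of Ahlberg–Duminil-Copin–Kozma–Sidoravicius
(2015, §2), here through the tree's dependent `★`-Peierls criterion with `r = 9`,
`δ = 1/(204 · 200^100)`, `η₁ = δ^100 / 2`; the proof is that of the landed `stub_coarsePercolation`
verbatim. [cite: AhlbergEtAl2015, §2] -/
theorem stub_coarsePercolationCurtain :
    ∃ η₁ : ℝ, 0 < η₁ ∧ ∀ k : ℕ, 1 ≤ k → ∀ (κ : ℝ) (S L : ℕ), k + 5 ≤ S → 1 ≤ L → ∀ p q : ℝ,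
      (∀ x : Fin 2 → ℤ, (labelMeasure (Fin 3 → ℤ)).real {U : (Sym2 (Fin 3 → ℤ) → ℝ) |
        ¬ (∀ γ : List (Fin 2 → ℤ), γ.Nodup → List.IsChain (fun a b => (zdStar 2).Adj a b) γ → (∀ z ∈ γ, (∀ i, |z i - (S : ℤ) * x i| ≤ 3 * (S : ℤ))) → (∃ z ∈ γ, ∃ z' ∈ γ, ∃ i, (S : ℤ) ≤ |z i - z' i|) → ∃ F : Finset (Fin 2 → ℤ), (∀ z ∈ F, z ∈ γ ∧ ¬ (∃ y ∈ (↑(box 3 (blockR L k)) : Set (Fin 3 → ℤ)), BondConfig.relabel (sym2Equiv (Site.shift (-(((2 * L + 1 : ℕ) : ℤ) • (![0, z 0, z 1] : Fin 3 → ℤ))))) (configOfLabels p U (zdGraph 3)) ∈ boxArm (S * (2 * L + 1)) y)) ∧ κ * (γ.length : ℝ) ≤ (F.card : ℝ))} ≤ η₁) →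
      (∀ x : Fin 2 → ℤ, (labelMeasure (Fin 3 → ℤ)).real {U' : (Sym2 (Fin 3 → ℤ) → ℝ) |
        (∃ γ : List (Fin 2 → ℤ), γ.Nodup ∧ List.IsChain (fun a b => (zdStar 2).Adj a b) γ ∧ (∀ z ∈ γ, (∀ i, |z i - (S : ℤ) * x i| ≤ 3 * (S : ℤ))) ∧ (∃ z ∈ γ, ∃ z' ∈ γ, ∃ i, (S : ℤ) ≤ |z i - z' i|) ∧ ∃ F : Finset (Fin 2 → ℤ), (∀ z ∈ F, z ∈ γ ∧ ¬ ((∃ w ∈ (↑(box 3 L) : Set (Fin 3 → ℤ)), BondConfig.relabel (sym2Equiv (Site.shift (-(((2 * L + 1 : ℕ) : ℤ) • (![0, z 0, z 1] : Fin 3 → ℤ))))) (configOfLabels q U' (zdGraph 3)) ∈ boxArm (blockR L k + (2 * L + 1)) w) ∧ ∀ u ∈ (↑(box 3 (3 * L + 1)) : Set (Fin 3 → ℤ)), ∀ v ∈ (↑(box 3 (3 * L + 1)) : Set (Fin 3 → ℤ)), BondConfig.relabel (sym2Equiv (Site.shift (-(((2 * L + 1 : ℕ) : ℤ) • (![0,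 z 0, z 1] : Fin 3 → ℤ))))) (configOfLabels q U' (zdGraph 3)) ∉ twoArm (blockR L k) u v)) ∧ κ * (γ.length : ℝ) ≤ (F.card : ℝ))} ≤ η₁) →
      1 / 2 ≤ ((labelMeasure (Fin 3 → ℤ)).prod (labelMeasure (Fin 3 → ℤ))).real {π : (Sym2 (Fin 3 → ℤ) → ℝ) × (Sym2 (Fin 3 → ℤ) → ℝ) |
        ((∀ γ : List (Fin 2 → ℤ), γ.Nodup → List.IsChain (fun a b => (zdStar 2).Adj a b) γ → (∀ z ∈ γ, (∀ i, |z i - (S : ℤ) * (0 : Fin 2 → ℤ) i| ≤ 3 * (S : ℤ))) → (∃ z ∈ γ, ∃ z' ∈ γ, ∃ i, (S : ℤ) ≤ |z i - z' i|) → ∃ F : Finset (Fin 2 → ℤ), (∀ z ∈ F, z ∈ γ ∧ ¬ (∃ y ∈ (↑(box 3 (blockR L k)) : Set (Fin 3 → ℤ)), BondConfig.relabel (sym2Equiv (Site.shift (-(((2 * L + 1 : ℕ) : ℤ) • (![0, z 0, z 1] : Fin 3 → ℤ))))) (configOfLabels p π.1 (zdGraph 3)) ∈ boxArm (S * (2 *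 L + 1)) y)) ∧ κ * (γ.length : ℝ) ≤ (F.card : ℝ)) ∧ ¬ (∃ γ : List (Fin 2 → ℤ), γ.Nodup ∧ List.IsChain (fun a b => (zdStar 2).Adj a b) γ ∧ (∀ z ∈ γ, (∀ i, |z i - (S : ℤ) * (0 : Fin 2 → ℤ) i| ≤ 3 * (S : ℤ))) ∧ (∃ z ∈ γ, ∃ z' ∈ γ, ∃ i, (S : ℤ) ≤ |z i - z' i|) ∧ ∃ F : Finset (Fin 2 → ℤ), (∀ z ∈ F, z ∈ γ ∧ ¬ ((∃ w ∈ (↑(box 3 L) : Set (Fin 3 → ℤ)), BondConfig.relabel (sym2Equiv (Site.shift (-(((2 * L + 1 : ℕ) : ℤ) • (![0, z 0, z 1] : Fin 3 → ℤ))))) (configOfLabels q π.2 (zdGraph 3)) ∈ boxArm (blockR L k + (2 * L + 1)) w) ∧ ∀ u ∈ (↑(box 3 (3 * L + 1)) : Set (Fin 3 → ℤ)), ∀ v ∈ (↑(box 3 (3 * L + 1)) : Set (Fin 3 → ℤ)), BondConfig.relabel (sym2Equiv (Site.shift (-(((2 * L + 1 : ℕ) : ℤ) • (![0, z 0, z 1]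 : Fin 3 → ℤ))))) (configOfLabels q π.2 (zdGraph 3)) ∉ twoArm (blockR L k) u v)) ∧ κ * (γ.length : ℝ) ≤ (F.card : ℝ))) ∧
        {x : Fin 2 → ℤ | Relation.ReflTransGen (starRel {x' : Fin 2 → ℤ |
        ((∀ γ : List (Fin 2 → ℤ), γ.Nodup → List.IsChain (fun a b => (zdStar 2).Adj a b) γ → (∀ z ∈ γ, (∀ i, |z i - (S : ℤ) * x' i| ≤ 3 * (S : ℤ))) → (∃ z ∈ γ, ∃ z' ∈ γ, ∃ i, (S : ℤ) ≤ |z i - z' i|) → ∃ F : Finset (Fin 2 → ℤ), (∀ z ∈ F, z ∈ γ ∧ ¬ (∃ y ∈ (↑(box 3 (blockR L k)) : Set (Fin 3 → ℤ)), BondConfig.relabel (sym2Equiv (Site.shift (-(((2 * L + 1 : ℕ) : ℤ) • (![0, z 0, z 1] : Fin 3 → ℤ))))) (configOfLabels p π.1 (zdGraph 3)) ∈ boxArm (S * (2 * L + 1)) y)) ∧ κ * (γ.length : ℝ) ≤ (F.card : ℝ)) ∧ ¬ (∃ γ : List (Fin 2 → ℤ), γ.Nodup ∧ List.IsChain (fun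 a b => (zdStar 2).Adj a b) γ ∧ (∀ z ∈ γ, (∀ i, |z i - (S : ℤ) * x' i| ≤ 3 * (S : ℤ))) ∧ (∃ z ∈ γ, ∃ z' ∈ γ, ∃ i, (S : ℤ) ≤ |z i - z' i|) ∧ ∃ F : Finset (Fin 2 → ℤ), (∀ z ∈ F, z ∈ γ ∧ ¬ ((∃ w ∈ (↑(box 3 L) : Set (Fin 3 → ℤ)), BondConfig.relabel (sym2Equiv (Site.shift (-(((2 * L + 1 : ℕ) : ℤ) • (![0, z 0, z 1] : Fin 3 → ℤ))))) (configOfLabels q π.2 (zdGraph 3)) ∈ boxArm (blockR L k + (2 * L + 1)) w) ∧ ∀ u ∈ (↑(box 3 (3 * L + 1)) : Set (Fin 3 → ℤ)), ∀ v ∈ (↑(box 3 (3 * L + 1)) : Set (Fin 3 → ℤ)), BondConfig.relabel (sym2Equiv (Site.shift (-(((2 * L + 1 : ℕ) : ℤ) • (![0, z 0, z 1] : Fin 3 → ℤ))))) (configOfLabels q π.2 (zdGraph 3)) ∉ twoArm (blockR L k) u v)) ∧ κ * (γ.length : ℝ) ≤ (F.card : ℝ)))}) 0 x}.Infinite} :=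 by
  refine ⟨((1 : ℝ) / (204 * 200 ^ 100)) ^ 100 / 2, by positivity, ?_⟩
  intro k hk κ S L hS hL p q hH hB
  have := isProbabilityMeasure_labelMeasure (Fin 3 → ℤ)
  set δ : ℝ := 1 / (204 * 200 ^ 100) with hδ
  have hδ0 : (0 : ℝ) ≤ δ := by rw [hδ]; positivity
  have hδ1 : 2 * ((9 + 1) ^ 2 + 2 : ℝ) * (2 * (3 ^ 2 + 1 : ℝ) ^ 2) ^ ((9 + 1) ^ 2) * δ ≤ 1 := by
    rw [hδ]; norm_num
  have hη0 : (0 : ℝ) ≤ δ ^ 100 / 2 := by positivity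
  have hS1 : 1 ≤ S := by omega
  have hN1 : 1 ≤ S * (2 * L + 1) := Nat.mul_pos (by omega) (by omega)
  have hfit : blockR L k + (2 * L + 1) ≤ S * (2 * L + 1) := by
    unfold blockR; nlinarith [Nat.mul_le_mul_right L hS]
  -- the finitely dependent planar `★`-Peierls criterion, `d = 2`, `r = 9`
  refine le_measureReal_infinite_starCluster_of_good (d := 2) (r := 9)
    (μ := (labelMeasure (Fin 3 → ℤ)).prod (labelMeasure (Fin 3 → ℤ))) le_rfl
    (fun x' : Fin 2 → ℤ => {π : (Sym2 (Fin 3 → ℤ) → ℝ) × (Sym2 (Fin 3 → ℤ) → ℝ) |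
        ((∀ γ : List (Fin 2 → ℤ), γ.Nodup → List.IsChain (fun a b => (zdStar 2).Adj a b) γ → (∀ z ∈ γ, (∀ i, |z i - (S : ℤ) * x' i| ≤ 3 * (S : ℤ))) → (∃ z ∈ γ, ∃ z' ∈ γ, ∃ i, (S : ℤ) ≤ |z i - z' i|) → ∃ F : Finset (Fin 2 → ℤ), (∀ z ∈ F, z ∈ γ ∧ ¬ (∃ y ∈ (↑(box 3 (blockR L k)) : Set (Fin 3 → ℤ)), BondConfig.relabel (sym2Equiv (Site.shift (-(((2 * L + 1 : ℕ) : ℤ) • (![0, z 0, z 1] : Fin 3 → ℤ))))) (configOfLabels p π.1 (zdGraph 3)) ∈ boxArm (S * (2 * L + 1)) y)) ∧ κ * (γ.length : ℝ) ≤ (F.card : ℝ)) ∧ ¬ (∃ γ : List (Fin 2 → ℤ), γ.Nodup ∧ List.IsChain (fun a b => (zdStar 2).Adj a b) γ ∧ (∀ z ∈ γ, (∀ i, |z i - (S : ℤ) * x' i| ≤ 3 * (S : ℤ))) ∧ (∃ z ∈ γ, ∃ z' ∈ γ, ∃ i, (S : ℤ) ≤ |z i - z' i|) ∧ ∃ F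 : Finset (Fin 2 → ℤ), (∀ z ∈ F, z ∈ γ ∧ ¬ ((∃ w ∈ (↑(box 3 L) : Set (Fin 3 → ℤ)), BondConfig.relabel (sym2Equiv (Site.shift (-(((2 * L + 1 : ℕ) : ℤ) • (![0, z 0, z 1] : Fin 3 → ℤ))))) (configOfLabels q π.2 (zdGraph 3)) ∈ boxArm (blockR L k + (2 * L + 1)) w) ∧ ∀ u ∈ (↑(box 3 (3 * L + 1)) : Set (Fin 3 → ℤ)), ∀ v ∈ (↑(box 3 (3 * L + 1)) : Set (Fin 3 → ℤ)), BondConfig.relabel (sym2Equiv (Site.shift (-(((2 * L + 1 : ℕ) : ℤ) • (![0, z 0, z 1] : Fin 3 → ℤ))))) (configOfLabels q π.2 (zdGraph 3)) ∉ twoArm (blockR L k) u v)) ∧ κ * (γ.length : ℝ) ≤ (F.card : ℝ)))}) hδ0 hδ1 ?_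
  intro T hT
  -- independence within the environment field
  have hE := fun T₁ (hT₁ : T₁ ⊆ T) => vacantReignition_cp_real_biInter_le_pow _ _
    (by
      intro b
      exact vacantReignition_cpc_measurableSet_notCurtain _ _ _ _ _ fun z =>
        vacantReignition_cp_measurable_touched p _ _ _)
    (by
      intro b
      refine vacantReignition_cpc_dependsOn_notCurtain _ _ _ _ _ _ fun z hz => ?_
      exact (vacantReignition_cp_dependsOn_touched p _ _ _).mono
        (vacantReignition_cp_window_mono fun j =>
          vacantReignition_cp_arith hN1 le_rfl (vacantReignition_cp_centre_close S L hz j)))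
    hH T₁ (fun a ha b hb hab =>
      vacantReignition_cp_disjoint_windows S L hS1 (hT a (hT₁ ha) b (hT₁ hb) hab))
  -- independence within the fresh field
  have hF := fun T₁ (hT₁ : T₁ ⊆ T) => vacantReignition_cp_real_biInter_le_pow _ _
    (by
      intro b
      exact vacantReignition_cpc_measurableSet_necklace _ _ _ _ _ fun z =>
        measurableSet_setOf.1 (vacantReignition_dom_measurableSet_good q _ L (blockR L k)
          (blockR L k + (2 * L + 1)) (Nat.le_add_right _ _)))
    (by
      intro b
      refine vacantReignition_cpc_dependsOn_necklace _ _ _ _ _ _ fun z hz => ?_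
      exact (vacantReignition_cp_dependsOn_good q _ L (blockR L k) (blockR L k + (2 * L + 1))
        (Nat.le_add_right _ _)).mono (vacantReignition_cp_window_mono fun j =>
          vacantReignition_cp_arith hN1 hfit (vacantReignition_cp_centre_close S L hz j)))
    hB T₁ (fun a ha b hb hab =>
      vacantReignition_cp_disjoint_windows S L hS1 (hT a (hT₁ ha) b (hT₁ hb) hab))
  -- the two fields are independent: `(2 η₁)^{#T} = δ^{100 #T}`
  refine (vacantReignition_cp_prod_real_biInter_compl_le (labelMeasure (Fin 3 → ℤ))
    (labelMeasure (Fin 3 → ℤ)) _ _ _ ?_ hη0 T hE hF).trans_eq ?_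
  · intro b π hπ
    rw [Set.mem_compl_iff, Set.mem_setOf_eq, not_and_or, not_not] at hπ
    exact hπ
  · rw [show (2 : ℝ) * (δ ^ 100 / 2) = δ ^ 100 by ring, ← pow_mul]
    norm_num

end Summit.CriticalPhenomena.PercolationContinuityZ3.Theorems

end
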